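import Summits.Schanuel.Schanuel.Theorems.RootDecomp1KSuperellipticSiegel06

/-!
# RootDecomp1KTrinomialDescent — lens 1, generation 64, NODE 25 «TRINOMIAL (FERMAT-QUOTIENT) DESCENT ON THE K-LINE — the curve X3 decided: EMPTY AT EVERY LEVEL» (×0-as-record under RULE K-R51 (i): for every trinomial σ₀Y^d + σ₁2^s·x^i·Y^k + σ₂x^j with Δ = (d−k)(j−i) − i·k odd ≥ 3 and primitive inner edges — the class FermatTri — NO rational point over any dyadic x = p/2^n, p odd, |p| ≠ 1, n ≥ 1, hence no level point for N ≥ 2 ⇒ LevelFinite / ThinFibreAt ∀ m₀ / BddLevelEmpty; X3 = x³ + Y·x + Y⁷ EMPTY at every level N ≥ 0; elementary: unique factorisation + parity; CLAIM L2956, PRICE L2959 (β), ERRATUM E3, RULE K-R56) — part 1 (RootDecomp1KTrinomialDescent01): §A arithmetic part 1: L1 parity lemmas, valuations (minimum attained twice), perfect powers from factorizations (section Arithmetic, to be continued)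

(lens-1 g64 NODE 25 «TRINOMIAL (FERMAT-QUOTIENT) DESCENT ON THE K-LINE — the curve X3 decided: EMPTY AT EVERY LEVEL» L2968: HOME kernel K = HOME/decomp-schanuel-lens-1/g64/lean/TrinomialDescent.lean sha256 e7961d57…, 1095 l, 95 decls, ONE namespace `Summit.Schanuel.Schanuel.Theorems.RootDecomp1KTrinomialDescent`, imports the tree port …RootDecomp1KSuperellipticSiegel06 ONLY; no private, no instance, no set_option, no notation, no sorry, no decide; lens farm: K rc 0 · 0 errors · 0 sorries, Probe rc 0 (155 `#print axioms` guards ⊆ the standard triple), Ctrl0 rc 0, Ctrl rc 1 = 35 planted errors exactly; CLAIM L2956 (ASK-FIRST under K-R55 (iii)); crit g12 PRICE L2959: RULING (β) ×0-AS-RECORD under RULE K-R51 (i) (descent lane: Chevalley–Weil along the étale μ₁₁-torsor defined by the ℚ-rational cuspidal 11-torsion of J_X3 + an elementary step upstairs) — «BUILD, ×0 VERDICT and RECORD PORT WELCOME AND REQUESTED»; ERRATUM E3 (critic's: X3 is NOT open territory — STRUCK as standing witness); RULE K-R56 PRE-ANNOUNCED; CHECKLIST K-g64 (1)–(9); census LIVENESS-v31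 (keys tri / cusp / jac of record L2969: FermatTri YES on X3 only, cuspidal group of order 11, census kit jac: #J_X3(𝔽_p) for p = 5, 13, 23 has gcd exactly 11); writer g34 NOTE 4 L2960 (pre-check 15/15 + 5/5); critic VERDICT: VERIFIED, OF RECORD: ×0-AS-RECORD under RULE K-R51 (i) (the descent lane; no credit class), VERDICT L2971 (crit-1 g12, 2026-09-02T00:18Z): CHECKLIST K-g64 (1)–(9) met item by item on the critic's own farm runs (K rc 0 · 0 errors · 0 sorries; Probe rc 0 with 155 `#print axioms` closures ⊆ the standard triple; Ctrl0 rc 0; Ctrl rc 1 = exactly the 35 planted errors; Pin25.lean 25/25); tally of record UNCHANGED lens-1 ×21 + THEOREM ×23; ERRATUM E3 FINAL (X3 = x³ + Y·x + Y⁷ STRUCK as standing witness: J_X3(ℚ)[11] ∋ [P₁ − P_∞] cuspidal; census jac gcd = 11 at p = 5, 13, 23); RULE K-R56 FIXED (+ the (d2) precision and GLOSS); PORT GO L2973 (×0 RECORD port, census-1; `--supports stmt-Schanuel-33364`, the item stays OPEN). Port by census-1 gen 24 as `RootDecomp1KTrinomialDescent01–05` (`--supports stmt-Schanuel-33364`;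 the item stays OPEN; ×0 record port, no credit anywhere): 01 = §A arithmetic part 1 (section Arithmetic: L1 parity lemmas `odd_geom_sum₂` / `le_geom_sum₂` / `pow_ne_pow_add_two_pow` / `eq_one_of_pow_add_pow_eq_two_pow` / `pow_ne_pow_add_two_pow_both`, valuations, perfect powers; section Arithmetic closed at the cut); 02 = §A part 2 (section Arithmetic re-opened: section Core — `perPrime`, `trinomial_core`); 03 = §B the term `triP` and the class `def FermatTri` (section Trinomial) + §C (M1) the 2-adic descent `den_of_root_triP` / `bev_triP_ne_zero_of_dyadic` (section TwoAdic) + §D the K-line doors `no_level_of_fermatTri` / `levelFinite_of_fermatTri` / `thinFibreAt_of_fermatTri` / `bddLevelEmpty_of_fermatTri` (section KLine); 04 = §F the term of record `X3P` (`bev_X3P`, `fermatTri_X3P`, `no_level_X3P`, `levelSet_X3P_eq_empty`, `levelFinite_X3P`, `thinFibreAt_X3P`, `bddLevelEmpty_X3P`) and the family `FT` (section Witness); 05 = §T territory refusals by tree names (`xdeg_X3P`, `not_domSuper_X3P`, `not_domHyper_X3P`, `den_of_level_X3P`, the class boundary `not_fermatTri_of_two_coeffs`, the nominee `X5P` typed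 as a NON-member) (section Territory) + §N sharpness (section Sharpness). Text = K VERBATIM (every declaration documented by the lens; statements and proofs unchanged; K's module docstring kept in part 01 below this provenance block).)
-/

/-!
# RootDecomp1KTrinomialDescent — lens 1, generation 64, NODE 25 «TRINOMIAL (FERMAT-QUOTIENT) DESCENT ON THE K-LINE — the curve X3 decided: EMPTY AT EVERY LEVEL»

HOME kernel `K = HOME/decomp-schanuel-lens-1/g64/lean/TrinomialDescent.lean`, ONE namespace
`Summit.Schanuel.Schanuel.Theorems.RootDecomp1KTrinomialDescent`, imports the tree port `…RootDecomp1KSuperellipticSiegel06`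
ONLY (node 24's class `DomSuper`, family `T j` and `exists_root_septic`, refused / cited in §T; everything else used is
node ≤ 23 tree material, cited BY NAME).  No `private`, no `instance`, no `set_option`, no notation, no sorry, no `decide`.
PRICED ×0-AS-RECORD (PRICE L2959, ruling (β) under RULE K-R51 (i): the lever below IS DESCENT — Chevalley–Weil along the
étale `μ_Δ`-cover of the trinomial curve by the Fermat curve of exponent `Δ`, with an elementary step upstairs); built
for the ×0 VERDICT and the RECORD PORT; ERRATUM E3 (critic's): `X3` is STRUCK as standing witness of K-R55 (ii).

## The lever: a FERMAT-QUOTIENT DESCENT for TRINOMIALS (descent lane of K-R51 (i))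

Write a trinomial level curve as `P = σ₀·Y^(m+k) + σ₁·2^s·x^i·Y^k + σ₂·x^(l+i)` (`σ_ν = ±1`; `d = m + k` the
`Y`-degree, `j = l + i` the `x`-degree; a genuine MIDDLE TERM `x^i·Y^k`, `i, k ≥ 1` — the NON-LACUNARY sector) and put
`Δ := l·m − i·k` (the determinant of the two inner Newton edges).  THE CLASS `FermatTri P`: `Δ` ODD and `≥ 3`,
PRIMITIVE edges `m ⊥ i`, `k ⊥ l`.  (In the PRICE's letters `(d, k, i, j, s)`: `m = d − k`, `l = j − i`.)

**THEOREM (`bev_triP_ne_zero`).**  For `P ∈ FermatTri` and every `x = p / 2^n` with `p` odd, `|p| ≠ 1`, `n ≥ 1`: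
`P(x, r) ≠ 0` for ALL `r ∈ ℚ`.  On the K-line (`x = s_N = p_N / 2^{N!}`, `p_N` odd `≥ 3` for `N ≥ 2`, by the tree's
`partialSum_eq_psNumer_div` / `coprime_psNumer` / `psNumer_succ`): NO rational point at ANY level `N ≥ 2`
(`no_level_of_fermatTri`), hence `LevelFinite`, `ThinFibreAt m₀` for EVERY `m₀` (no `m₀`-guard), `BddLevelEmpty`
(`levelFinite_of_fermatTri`, `thinFibreAt_of_fermatTri`, `bddLevelEmpty_of_fermatTri`, through the tree's
`levelFinite_of_no_level` / `thinFibreAt_of_levelFinite` / `bddLevelEmpty_iff_levelFinite`) — hypothesis-free.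

**THE CURVE `X3 = x³ + Y·x + Y⁷`** (`X3P := xPolyP 3 x3C`, the node-24 Probe spelling `xPolyP 3 [Y⁷, Y, 0, 1]`; its FIRST
tree name; `(m,i,k,l) = (6,1,1,2)`, `Δ = 11`): `X3P_eq_triP`, `fermatTri_X3P`, and — the two small levels by hand
(`N = 0`: `7e = 3` impossible; `N = 1`: `r⁷ + r + 1` has no rational root) — **`no_level_X3P : ∀ N r,
bev X3P (partialSum 2 N) r ≠ 0`**, `levelSet_X3P_eq_empty`, `levelFinite_X3P`, `thinFibreAt_X3P : ∀ m₀, ThinFibreAt m₀ X3P`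
(in particular `m₀ = 2`), `bddLevelEmpty_X3P`, `X3P_territory`.  The family `FT m l = Y^(m+1) + x·Y + x^(l+1)` (`l·m`
even `≥ 4`; `X3P = FT 6 2`; PRICE box `fermatTri_FT_deg`) is decided wholesale (`fermatTri_FT`, `no_level_FT`, …).

Proof in three moves, all elementary and all typed here:
(M1) `descent_triP` — clearing denominators at `x = p/2^n`, an odd prime in `den r` is impossible (Gauss), `den r = 2^e`
with `e ≥ 1` (parity), and among the three 2-adic weights `n(l+i)`, `s + nl + em`, `e(m+k)` the two least tie
(`two_adic_tie`); the ties through the middle term contradict `lm > ik` (`weights_absurd`), so the OUTER edges tie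
(`den_eq_two_pow_of_root_triP`: the far segment `n·(l+i) = e·(m+k)`) and the equation descends to the ODD CORE
`σ₀u^(m+k) + σ₁2^M p^i u^k + σ₂p^(l+i) = 0` (`p, u` odd, `M ≥ 0`).
(M2) `perPrime` / `trinomial_core` — at every odd prime the exponent vector `(v_q p, v_q u)` lies on `ℕ·(m,i)` or
`ℕ·(k,l)` (valuations tie twice; primitivity), so `u^k ∣ p^l`, `p^i ∣ u^m` and the quotients `p^l/u^k`, `u^m/p^i` are
`Δ`-th POWERS (`exists_pow_eq_of_dvd_factorization`); dividing the core by `p^i u^k` leaves `±a^Δ ± b^Δ ± 2^M = 0`.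
(M3) `pow_ne_pow_add_two_pow` / `eq_one_of_pow_add_pow_eq_two_pow` — for odd `a, b` and odd `Δ ≥ 3` the cofactor
`Φ_Δ(a, ∓b)` is ODD and `≥ 3` (resp. `= 1` forces `a = b = 1`) yet divides `2^M`: only `a = b = 1`, i.e. `|p| = 1`.

§T (territory / class boundary): `xdeg X3P = 3`, `xCoeff X3P 1 = X ≠ 0` (NON-LACUNARY), `¬ DomSuper X3P`,
`¬ DomHyper X3P`, real-live at every abscissa (`exists_real_root_X3P`, the tree's `exists_root_septic`), every fibre
non-degenerate, the 2-adic far segment `7e = 3n` (`den_of_root_X3P`); the CLASS BOUNDARY INSTRUMENT `eq_of_fermatTri`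
(every `x`-coefficient of a member is a monomial in `Y`) types the NON-members `W4P`, `T j`, `H17P`, `RW w`, `quartP` and
the critic's nominee `X5P = x³ + Y·x + Y⁷ + 2` (NOT reached here).  §N (sharpness, typed points): `|p| ≠ 1`
(Y³+xY+x³ ∋ (−1/2, −1/2)), `2 ≤ N` (Y⁵+2xY²−x⁴ ∋ (s_1, −1)), `Δ odd` (Y²+8xY−x⁴ ∋ (15/2, 135/4); Y²+xY−x⁴ ∋ (3/8, −27/64)),
`m ⊥ i` (Y⁴+x³Y−x⁵ ∋ (9/16, 9/32)), `k ⊥ l` (−Y⁵+xY³+x⁴ ∋ (9/32, 9/16)).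
HONESTY: rung 0 — `FiniteOrderLiouvilleSchanuel` (item 33364), 33363, 31077, the residual 31987, the uniform `ThinFibre 2`
and every binder of record are UNMOVED; the standing witness `W4` (non-dominant) is NOT reached; nothing here proves
Schanuel.
-/

noncomputable section

namespace Summit.Schanuel.Schanuel.Theorems.RootDecomp1KTrinomialDescent

open Polynomial Finset
open LiouvilleNumber
open scoped Nat
open Summit.Schanuel.Schanuel.Theorems.RootDecomp1KDegreeLadder
open Summit.Schanuel.Schanuel.Theorems.RootDecomp1KXTop
open Summit.Schanuel.Schanuel.Theorems.RootDecomp1KXAll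
open Summit.Schanuel.Schanuel.Theorems.RootDecomp1KLevelFinite
open Summit.Schanuel.Schanuel.Theorems.RootDecomp1KHeightGrading (BddLevelEmpty bddLevelEmpty_iff_levelFinite H17P h17C
  h17C_one)
open Summit.Schanuel.Schanuel.Theorems.RootDecomp1KOddEmpty (levelFinite_of_no_level W4P w4C)
open Summit.Schanuel.Schanuel.Theorems.RootDecomp1KTwoBaseCell (psNumer partialSum_eq_psNumer_div coprime_psNumer)
open Summit.Schanuel.Schanuel.Theorems.RootDecomp1KRelLiouvilleCell (partialSum_two_zero)
open Summit.Schanuel.Schanuel.Theorems.RootDecomp1KRunge (psNumer_pos_runge RW rwC rwC_four)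
open Summit.Schanuel.Schanuel.Theorems.RootDecomp1KSuperellipticSiegel (DomSuper exists_root_septic T tC A xCoeff_T
  tC_zero coeff_A_seven coeff_A_zero twoTermC twoTermP_eq_xPolyP)
open Summit.Schanuel.Schanuel.Theorems.RootDecomp1KHyperellipticSiegel (DomHyper)

/-! ## §A  ARITHMETIC: the parity lemmas (M3), valuations, perfect powers, the core (M2) -/

section Arithmetic

/-! ### L1 parity lemmas -/

/-- the geometric cofactor `Φ = Σ_{i<D} a^i b^(D-1-i)` of two odd naturals over an odd number `D` of terms is odd. -/
theorem odd_geom_sum₂ {a b D : ℕ} (ha : Odd a) (hb : Odd b) (hD : Odd D) :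
    Odd (∑ i ∈ range D, a ^ i * b ^ (D - 1 - i)) := by
  rw [Nat.odd_iff, Finset.sum_nat_mod, Finset.sum_congr rfl (g := fun _ => 1)]
  · rw [Finset.sum_const, Finset.card_range, smul_eq_mul, mul_one]
    exact Nat.odd_iff.mp hD
  · intro i _
    exact Nat.odd_iff.mp ((ha.pow).mul (hb.pow))

/-- lower bound `D ≤ Φ` (every term is `≥ 1`). -/
theorem le_geom_sum₂ {a b D : ℕ} (ha : 0 < a) (hb : 0 < b) :
    D ≤ ∑ i ∈ range D, a ^ i * b ^ (D - 1 - i) := by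
  calc D = ∑ i ∈ range D, 1 := by simp
    _ ≤ ∑ i ∈ range D, a ^ i * b ^ (D - 1 - i) :=
        Finset.sum_le_sum fun i _ => Nat.one_le_iff_ne_zero.mpr
          (Nat.mul_ne_zero (pow_ne_zero _ ha.ne') (pow_ne_zero _ hb.ne'))

/-- **(L1a)** `a^D = b^D + 2^M` is impossible for odd `a, b` and odd `D ≥ 3`. -/
theorem pow_ne_pow_add_two_pow {a b D : ℕ} (ha : Odd a) (hb : Odd b) (hD : Odd D) (hD3 : 3 ≤ D) (M : ℕ) :
    a ^ D ≠ b ^ D + 2 ^ M := by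
  intro h
  have h2M : 0 < 2 ^ M := by positivity
  have hba : b ≤ a := by
    by_contra hlt
    have : a ^ D < b ^ D := Nat.pow_lt_pow_left (by omega) (by omega)
    omega
  have key : (∑ i ∈ range D, a ^ i * b ^ (D - 1 - i)) * (a - b) = 2 ^ M := by
    rw [geom_sum₂_mul_of_ge hba, h]; exact Nat.add_sub_cancel_left _ _
  have hdvd : (∑ i ∈ range D, a ^ i * b ^ (D - 1 - i)) ∣ 2 ^ M := Dvd.intro _ key
  have h1 : (∑ i ∈ range D, a ^ i * b ^ (D - 1 - i)) = 1 :=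
    Nat.Coprime.eq_one_of_dvd ((Nat.coprime_two_right.mpr (odd_geom_sum₂ ha hb hD)).pow_right M) hdvd
  have h3 := le_geom_sum₂ (D := D) ha.pos hb.pos
  omega

/-- **(L1b)** `a^D + b^D = 2^M` forces `a = b = 1` for odd `a, b` and odd `D ≥ 3`. -/
theorem eq_one_of_pow_add_pow_eq_two_pow {a b D : ℕ} (ha : Odd a) (hb : Odd b) (hD : Odd D) (hD3 : 3 ≤ D)
    {M : ℕ} (h : a ^ D + b ^ D = 2 ^ M) : a = 1 ∧ b = 1 := by
  -- over ℤ: Ψ · (a + b) = a^D - (-b)^D = a^D + b^D = 2^M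
  set Ψ : ℤ := ∑ i ∈ range D, (a : ℤ) ^ i * (-(b : ℤ)) ^ (D - 1 - i) with hΨ
  have key : Ψ * ((a : ℤ) + b) = 2 ^ M := by
    have e := geom_sum₂_mul (a : ℤ) (-(b : ℤ)) D
    rw [hD.neg_pow, sub_neg_eq_add, sub_neg_eq_add] at e
    rw [e]; exact_mod_cast h
  have hΨodd : Odd Ψ := by
    rw [Int.odd_iff, hΨ, Finset.sum_int_mod, Finset.sum_congr rfl (g := fun _ => 1)]
    · rw [Finset.sum_const, Finset.card_range, nsmul_eq_mul, mul_one]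
      exact Int.odd_iff.mp (hD.natCast (R := ℤ))
    · intro i _
      have hai : Odd ((a : ℤ) ^ i) := (ha.natCast (R := ℤ)).pow
      have hbi : Odd ((-(b : ℤ)) ^ (D - 1 - i)) := (hb.natCast (R := ℤ)).neg.pow
      exact Int.odd_iff.mp (hai.mul hbi)
  have hdvd : Ψ.natAbs ∣ 2 ^ M := by
    have : Ψ ∣ (2 : ℤ) ^ M := Dvd.intro _ key
    have := Int.natAbs_dvd_natAbs.mpr this
    simpa [Int.natAbs_pow] using this
  have h1 : Ψ.natAbs = 1 :=
    Nat.Coprime.eq_one_of_dvd ((Nat.coprime_two_right.mpr (Int.natAbs_odd.mpr hΨodd)).pow_right M) hdvd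
  have hab : (a : ℤ) ^ D + b ^ D = a + b := by
    have h' : Ψ * ((a : ℤ) + b) = (a : ℤ) ^ D + b ^ D := by rw [key]; exact_mod_cast h.symm
    rcases Int.natAbs_eq Ψ with hs | hs <;> rw [h1] at hs <;> rw [hs] at h' <;> push_cast at h' ⊢
    · linarith
    · have : (0 : ℤ) ≤ (a : ℤ) ^ D + b ^ D := by positivity
      have ha0 : (0 : ℤ) < a := by exact_mod_cast ha.pos
      have hb0 : (0 : ℤ) < b := by exact_mod_cast hb.pos
      nlinarith
  have hab' : a ^ D + b ^ D = a + b := by exact_mod_cast hab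
  have hD0 : D ≠ 0 := by omega
  have haD : a ≤ a ^ D := Nat.le_self_pow hD0 a
  have hbD : b ≤ b ^ D := Nat.le_self_pow hD0 b
  have haD' : a ^ D = a := by omega
  have hbD' : b ^ D = b := by omega
  have hpow : ∀ {c : ℕ}, Odd c → c ^ D = c → c = 1 := by
    intro c hc hcD
    have hc0 : 0 < c := hc.pos
    have : c ^ (D - 1) = 1 := by
      have e : c ^ D = c ^ (D - 1) * c := by rw [← pow_succ]; congr 1; omega
      rw [e] at hcD
      nlinarith [Nat.eq_of_mul_eq_mul_right hc0 (hcD.trans (one_mul c).symm)]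
    rcases Nat.pow_eq_one.mp this with h | h
    · exact h
    · omega
  exact ⟨hpow ha haD', hpow hb hbD'⟩

/-- **(L1) in the PRICE's two-sided, subtraction-safe form**: `a^Δ ≠ B^Δ + 2^M ∧ B^Δ ≠ a^Δ + 2^M`. -/
theorem pow_ne_pow_add_two_pow_both {a b D : ℕ} (ha : Odd a) (hb : Odd b) (hD : Odd D) (hD3 : 3 ≤ D) (M : ℕ) :
    a ^ D ≠ b ^ D + 2 ^ M ∧ b ^ D ≠ a ^ D + 2 ^ M :=
  ⟨pow_ne_pow_add_two_pow ha hb hD hD3 M, pow_ne_pow_add_two_pow hb ha hD hD3 M⟩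

/-! ### valuations: minimum attained twice -/

/-- `{q X Y : ℕ} (hq : q.Prime) (hY : Y ≠ 0) : min (X.factorization q) (Y.factorization q) ≤ (X + Y).factorization q`. -/
theorem min_le_factorization_add {q X Y : ℕ} (hq : q.Prime) (hY : Y ≠ 0) :
    min (X.factorization q) (Y.factorization q) ≤ (X + Y).factorization q := by
  have h1 : q ^ min (X.factorization q) (Y.factorization q) ∣ X :=
    (pow_dvd_pow q (min_le_left _ _)).trans (Nat.ordProj_dvd X q)
  have h2 : q ^ min (X.factorization q) (Y.factorization q) ∣ Y :=
    (pow_dvd_pow q (min_le_right _ _)).trans (Nat.ordProj_dvd Y q)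
  exact (hq.pow_dvd_iff_le_factorization (by omega)).mp (Nat.dvd_add h1 h2)

/-- if `X + Y = Z` (all non-zero) the two smallest `q`-adic valuations among `X, Y, Z` coincide. -/
theorem ties_of_add_eq {q X Y Z : ℕ} (hq : q.Prime) (hX : X ≠ 0) (hY : Y ≠ 0) (h : X + Y = Z) :
    (X.factorization q = Y.factorization q ∧ X.factorization q ≤ Z.factorization q) ∨
    (X.factorization q = Z.factorization q ∧ X.factorization q < Y.factorization q) ∨
    (Y.factorization q = Z.factorization q ∧ Y.factorization q < X.factorization q) := by
  have hZ : Z ≠ 0 := by omega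
  have m1 := min_le_factorization_add (X := X) hq hY
  rw [h] at m1
  have m2 : min (Y.factorization q) (Z.factorization q) ≤ X.factorization q := by
    have h1 : q ^ min (Y.factorization q) (Z.factorization q) ∣ Y :=
      (pow_dvd_pow q (min_le_left _ _)).trans (Nat.ordProj_dvd Y q)
    have h2 : q ^ min (Y.factorization q) (Z.factorization q) ∣ Z :=
      (pow_dvd_pow q (min_le_right _ _)).trans (Nat.ordProj_dvd Z q)
    have h3 : q ^ min (Y.factorization q) (Z.factorization q) ∣ Z - Y := Nat.dvd_sub h2 h1
    rw [show Z - Y = X by omega] at h3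
    exact (hq.pow_dvd_iff_le_factorization hX).mp h3
  have m3 : min (X.factorization q) (Z.factorization q) ≤ Y.factorization q := by
    have h1 : q ^ min (X.factorization q) (Z.factorization q) ∣ X :=
      (pow_dvd_pow q (min_le_left _ _)).trans (Nat.ordProj_dvd X q)
    have h2 : q ^ min (X.factorization q) (Z.factorization q) ∣ Z :=
      (pow_dvd_pow q (min_le_right _ _)).trans (Nat.ordProj_dvd Z q)
    have h3 : q ^ min (X.factorization q) (Z.factorization q) ∣ Z - X := Nat.dvd_sub h2 h1
    rw [show Z - X = Y by omega] at h3
    exact (hq.pow_dvd_iff_le_factorization hY).mp h3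
  omega

/-! ### perfect powers from factorizations -/

/-- a natural number all of whose prime exponents are divisible by `D` is a `D`-th power. -/
theorem exists_pow_eq_of_dvd_factorization {n D : ℕ} (hn : n ≠ 0) (h : ∀ q, D ∣ n.factorization q) :
    ∃ r, r ^ D = n := by
  refine ⟨n.factorization.prod fun q e => q ^ (e / D), ?_⟩
  calc (n.factorization.prod fun q e => q ^ (e / D)) ^ D
      = n.factorization.prod fun q e => q ^ e := by
        rw [Finsupp.prod, Finsupp.prod, ← Finset.prod_pow]
        refine Finset.prod_congr rfl fun q _ => ?_
        rw [← pow_mul, Nat.div_mul_cancel (h q)]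
    _ = n := Nat.prod_factorization_pow_eq_self hn

end Arithmetic

end Summit.Schanuel.Schanuel.Theorems.RootDecomp1KTrinomialDescent

end
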